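import Literature.Analysis.FluidPDE.AdaptedBackwardKernel
import Literature.Analysis.FluidPDE.ClassicalSolutionRescale
import HarnessLib

/-!
# Parabolic zoom covariance of adapted kernels and of Gaussian comparability
# (route `AdaptedFrequency`, item `TangentFlowTransfer`, stmt-NavierStokesRegularity-10494)

Helper file (all results proved) for the Type-I compactness transfer `TangentFlowTransfer`.
Its first step is the parabolic zoom about the backward-singular point `(T, x₀)`:
`u_c(s, y) = c u(T + c² s, x₀ + c y)`, `G_c(s, y) = cⁿ G(T + c² s, x₀ + c y)`
(`Φ(s, y) = (T + c² s, x₀ + c y)`, `c > 0`, `n = dim E`; in the tree's vocabulary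
`u_c = c • stPull (c²) c T x₀ u`, `G_c = cⁿ • stPull (c²) c T x₀ G`). This file proves that the
kernel clauses the item carries are **covariant with the same constants**:

* `preimage_zoomTime_Ico` / `preimage_zoomTime_Ioo`, `tendsto_zoomTime_nhdsLT`: the time window
  `[t₀, T)` becomes `[(t₀ − T)/c², 0)` and `s ↑ 0` corresponds to `t ↑ T`;
* `isAdaptedBackwardKernel_zoom` (`_Ico`): the five kernel clauses of
  `Literature.Analysis.FluidPDE.IsAdaptedBackwardKernel` (`C²`, `G > 0`, adjoint equation
  `∂ₜG + u·∇G + νΔG = 0`, unit mass, concentration at the pole) pass from `(u, G)` on `S` with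
  pole `(T, x₀)` to `(u_c, G_c)` on `Φ⁻¹(S)` with pole `(0, 0)` (every term of the adjoint
  equation scales by `cⁿ⁺²`; mass and concentration by the change of variables `x = x₀ + c y`,
  the test function being transported to `φ((x − x₀)/c)`);
* `gaussian_bounds_zoom`, `isGaussianComparable_zoom`: two-sided Gaussian comparability with the
  SAME constants `c₁, c₂, C₁, C₂` (`cⁿ (c² a)^{-n/2} = a^{-n/2}`, `‖c y‖²/(k c² a) = ‖y‖²/(k a)`).

The companion file `AdaptedFrequencyTangentFlowTransferZoomFrequency` treats the adapted
enstrophy/frequency and the solution-side clauses. The compactness itself is not here.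

References: J. Leray, Acta Math. 63 (1934), §20 (similarity transformation);
G. Koch, N. Nadirashvili, G. Seregin, V. Šverák, Acta Math. 203 (2009) = arXiv:0709.3599, §6 (6.2)
(zoom about a space–time point); A. Friedman, *PDE of Parabolic Type* (1964), Ch. 1 §8 (adjoint
equation); D. G. Aronson, Bull. AMS 73 (1967), Thm 1 (Gaussian bounds).
-/

noncomputable section

open MeasureTheory Set Function Filter TopologicalSpace Metric
open scoped Topology NNReal ENNReal InnerProductSpace Laplacian

namespace Summit.NavierStokesRegularity.NavierStokesRegularity.Theorems

open Literature.Analysis Literature.Analysis.FluidPDE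

/-! ### The time window under the zoom -/

section Time

/-- The zoom time map `s ↦ T + c² s` pulls `[t₀, T)` back to `[(t₀ − T)/c², 0)` (`c ≠ 0`).
[folklore] -/
theorem preimage_zoomTime_Ico {c : ℝ} (hc : c ≠ 0) (t₀ T : ℝ) :
    (fun r : ℝ => T + c ^ 2 * r) ⁻¹' Ico t₀ T = Ico ((t₀ - T) / c ^ 2) 0 := by
  have hc2 : 0 < c ^ 2 := by positivity
  ext r
  simp only [mem_preimage, mem_Ico]
  constructor
  · rintro ⟨h1, h2⟩
    refine ⟨?_, ?_⟩
    · rw [div_le_iff₀ hc2]; linarith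
    · nlinarith
  · rintro ⟨h1, h2⟩
    rw [div_le_iff₀ hc2] at h1
    refine ⟨by linarith, ?_⟩
    nlinarith

/-- The zoom time map `s ↦ T + c² s` pulls `(t₁, T)` back to `((t₁ − T)/c², 0)` (`c ≠ 0`).
[folklore] -/
theorem preimage_zoomTime_Ioo {c : ℝ} (hc : c ≠ 0) (t₁ T : ℝ) :
    (fun r : ℝ => T + c ^ 2 * r) ⁻¹' Ioo t₁ T = Ioo ((t₁ - T) / c ^ 2) 0 := by
  have hc2 : 0 < c ^ 2 := by positivity
  ext r
  simp only [mem_preimage, mem_Ioo]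
  constructor
  · rintro ⟨h1, h2⟩
    refine ⟨?_, ?_⟩
    · rw [div_lt_iff₀ hc2]; linarith
    · nlinarith
  · rintro ⟨h1, h2⟩
    rw [div_lt_iff₀ hc2] at h1
    refine ⟨by linarith, ?_⟩
    nlinarith

/-- The zoom time map tends to `T` from below as `s ↑ 0` (`c ≠ 0`). [folklore] -/
theorem tendsto_zoomTime_nhdsLT {c : ℝ} (hc : c ≠ 0) (T : ℝ) :
    Tendsto (fun s : ℝ => T + c ^ 2 * s) (𝓝[<] 0) (𝓝[<] T) := by
  have hc2 : 0 < c ^ 2 := by positivity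
  have hcont : Continuous fun s : ℝ => T + c ^ 2 * s := by fun_prop
  refine tendsto_nhdsWithin_of_tendsto_nhds_of_eventually_within _ ?_ ?_
  · have := (hcont.tendsto 0).mono_left (nhdsWithin_le_nhds (s := Iio (0 : ℝ)))
    simpa using this
  · filter_upwards [self_mem_nhdsWithin] with s hs
    have : c ^ 2 * s < 0 := mul_neg_of_pos_of_neg hc2 hs
    simp only [mem_Iio]
    linarith

/-- For a window time `s` with `T + c² s < T`, i.e. `s < 0`: `T − (T + c² s) = c² (0 − s)`.
[folklore] -/
theorem sub_zoomTime (c T s : ℝ) : T - (T + c ^ 2 * s) = c ^ 2 * (0 - s) := by ring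

end Time

/-! ### Kernel clauses under the zoom -/

section Kernel

variable {E : Type*} [NormedAddCommGroup E] [InnerProductSpace ℝ E] [FiniteDimensional ℝ E]
  [MeasurableSpace E] [BorelSpace E]

omit [FiniteDimensional ℝ E] [MeasurableSpace E] [BorelSpace E] in
/-- Joint `C²` regularity is preserved by the (amplitude-scaled) affine pull-back. [folklore] -/
theorem contDiffOn_two_uncurry_smul_stPull {S : Set ℝ} {G : ℝ → E → ℝ}
    (h : ContDiffOn ℝ 2 (uncurry G) (S ×ˢ univ)) (α β γ t₀ : ℝ) (x₀ : E) :
    ContDiffOn ℝ 2 (uncurry (α • stPull β γ t₀ x₀ G))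
      (((fun r => t₀ + β * r) ⁻¹' S) ×ˢ (univ : Set E)) := by
  have hmaps : MapsTo (stAffine β γ t₀ x₀) (((fun r => t₀ + β * r) ⁻¹' S) ×ˢ (univ : Set E))
      (S ×ˢ univ) := fun z hz => mk_mem_prod (by simpa [stAffine_apply] using hz.1) (mem_univ _)
  have hcomp : ContDiffOn ℝ 2 (uncurry G ∘ stAffine β γ t₀ x₀)
      (((fun r => t₀ + β * r) ⁻¹' S) ×ˢ (univ : Set E)) :=
    h.comp (contDiff_stAffine β γ t₀ x₀).contDiffOn hmaps
  have := hcomp.const_smul α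
  refine this.congr fun z _ => ?_
  obtain ⟨s, y⟩ := z
  simp [stAffine_apply]

omit [FiniteDimensional ℝ E] [MeasurableSpace E] [BorelSpace E] in
/-- Slices of a jointly `C²` field are `C²`. [folklore] -/
theorem contDiff_two_slice_of_contDiffOn {S : Set ℝ} {G : ℝ → E → ℝ}
    (h : ContDiffOn ℝ 2 (uncurry G) (S ×ˢ univ)) {t : ℝ} (ht : t ∈ S) : ContDiff ℝ 2 (G t) := by
  have hc : ContDiff ℝ 2 (fun x : E => ((t, x) : ℝ × E)) := contDiff_const.prodMk contDiff_id
  have := h.comp_contDiff hc (fun x => mk_mem_prod ht (mem_univ x))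
  simpa [Function.comp_def] using this

omit [FiniteDimensional ℝ E] [MeasurableSpace E] [BorelSpace E] in
/-- The zoomed kernel, unfolded: `(α • stPull β γ t₀ x₀ G) s y = α * G (t₀ + β s) (x₀ + γ y)`.
[folklore] -/
theorem smul_stPull_kernel_apply (α β γ t₀ : ℝ) (x₀ : E) (G : ℝ → E → ℝ) (s : ℝ) (y : E) :
    (α • stPull β γ t₀ x₀ G) s y = α * G (t₀ + β * s) (x₀ + γ • y) := by
  simp [stPull_apply]

/-- **The five kernel clauses are covariant under the parabolic zoom.** If `G` is a flow-adapted
backward kernel of `∂ₜ + u·∇ − νΔ` on the time set `S` with pole `(T, x₀)`, then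
`G_c = cⁿ G ∘ Φ` is a flow-adapted backward kernel of the zoomed drift `u_c = c u ∘ Φ` on
`Φ⁻¹(S)` with pole `(0, 0)`, `Φ(s, y) = (T + c² s, x₀ + c y)`, `c > 0`, `n = dim E`: the adjoint
equation scales by `cⁿ⁺²` termwise (`timeDerivWithin_smul_stPull`, `fderiv_stPull`,
`laplacian_stPull`), the mass by `cⁿ · c⁻ⁿ = 1` (`integral_comp_space_affine`), and
`∫ φ(y) G_c(s, y) dy = ∫ φ((x − x₀)/c) G(T + c² s, x) dx → φ(0)` as `s ↑ 0`. [folklore] -/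
theorem isAdaptedBackwardKernel_zoom {ν : ℝ} {u : ℝ → E → E} {S : Set ℝ} {T : ℝ} {x₀ : E}
    {G : ℝ → E → ℝ} (hG : IsAdaptedBackwardKernel ν u S T x₀ G) {c : ℝ} (hc : 0 < c) :
    IsAdaptedBackwardKernel ν (c • stPull (c ^ 2) c T x₀ u) ((fun r => T + c ^ 2 * r) ⁻¹' S) 0 0
      ((c ^ Module.finrank ℝ E) • stPull (c ^ 2) c T x₀ G) where
  contDiffOn := contDiffOn_two_uncurry_smul_stPull hG.contDiffOn _ _ _ _ _
  pos s hs y := by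
    rw [smul_stPull_kernel_apply]
    exact mul_pos (pow_pos hc _) (hG.pos _ hs _)
  adjoint_eq s hs y := by
    set n := Module.finrank ℝ E with hn
    have hc2 : (c ^ 2 : ℝ) ≠ 0 := by positivity
    have ht : T + c ^ 2 * s ∈ S := hs
    have hG2 : ContDiff ℝ 2 (G (T + c ^ 2 * s)) := hG.contDiff_slice ht
    -- time derivative
    rw [timeDerivWithin_smul_stPull S G (c ^ n) hc2 c T x₀ s y]
    -- drift term
    have hdrift : fderiv ℝ (((c ^ n) • stPull (c ^ 2) c T x₀ G) s) y
        ((c • stPull (c ^ 2) c T x₀ u) s y) =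
        (c ^ n * c ^ 2) * fderiv ℝ (G (T + c ^ 2 * s)) (x₀ + c • y) (u (T + c ^ 2 * s) (x₀ + c • y)) := by
      rw [show ((c ^ n) • stPull (c ^ 2) c T x₀ G) s = (c ^ n) • stPull (c ^ 2) c T x₀ G s from rfl,
        fderiv_const_smul_field, Pi.smul_apply, fderiv_stPull]
      simp only [FunLike.coe_smul, Pi.smul_apply, stPull_apply, map_smul, smul_eq_mul]
      ring
    rw [hdrift]
    -- Laplacian
    have hlap : (Δ (((c ^ n) • stPull (c ^ 2) c T x₀ G) s)) y =
        (c ^ n * c ^ 2) * (Δ (G (T + c ^ 2 * s))) (x₀ + c • y) := by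
      have h2' : ContDiffAt ℝ 2 (stPull (c ^ 2) c T x₀ G s) y := (contDiff_stPull_slice hG2).contDiffAt
      rw [show ((c ^ n) • stPull (c ^ 2) c T x₀ G) s = (c ^ n) • stPull (c ^ 2) c T x₀ G s from rfl,
        InnerProductSpace.laplacian_smul (c ^ n) h2', laplacian_stPull (c ^ 2) c T x₀ G s y hG2]
      simp only [smul_eq_mul]
      ring
    rw [hlap]
    have key := hG.adjoint_eq (T + c ^ 2 * s) ht (x₀ + c • y)
    have : (c ^ n * c ^ 2) * (timeDerivWithin S G (T + c ^ 2 * s) (x₀ + c • y) +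
        fderiv ℝ (G (T + c ^ 2 * s)) (x₀ + c • y) (u (T + c ^ 2 * s) (x₀ + c • y)) +
        ν * (Δ (G (T + c ^ 2 * s))) (x₀ + c • y)) = 0 := by rw [key, mul_zero]
    simp only [smul_eq_mul]
    linear_combination this
  integral_eq_one s hs := by
    set n := Module.finrank ℝ E with hn
    have ht : T + c ^ 2 * s ∈ S := hs
    have h1 : (fun y => ((c ^ n) • stPull (c ^ 2) c T x₀ G) s y) =
        fun y => c ^ n * (fun x => G (T + c ^ 2 * s) x) (x₀ + c • y) := by
      funext y; rw [smul_stPull_kernel_apply]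
    rw [h1, integral_const_mul, integral_comp_space_affine hc x₀ (fun x => G (T + c ^ 2 * s) x),
      hG.integral_eq_one _ ht]
    rw [smul_eq_mul, mul_one, ← hn, mul_inv_cancel₀ (by positivity)]
  tendsto_integral_mul φ hφ hφb := by
    set n := Module.finrank ℝ E with hn
    obtain ⟨M, hM⟩ := hφb
    -- the transported test function
    set ψ : E → ℝ := fun x => φ (c⁻¹ • (x - x₀)) with hψ
    have hψc : Continuous ψ := hφ.comp ((continuous_id.sub continuous_const).const_smul _)
    have hψb : ∃ M : ℝ, ∀ x, |ψ x| ≤ M := ⟨M, fun x => hM _⟩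
    have hlim := hG.tendsto_integral_mul ψ hψc hψb
    have hψ0 : ψ x₀ = φ 0 := by simp [hψ]
    rw [hψ0] at hlim
    -- identify the integrals
    have hint : ∀ s : ℝ, ∫ y, φ y * ((c ^ n) • stPull (c ^ 2) c T x₀ G) s y =
        ∫ x, ψ x * G (T + c ^ 2 * s) x := by
      intro s
      have h1 : (fun y => φ y * ((c ^ n) • stPull (c ^ 2) c T x₀ G) s y) =
          fun y => c ^ n * (fun x => ψ x * G (T + c ^ 2 * s) x) (x₀ + c • y) := by
        funext y
        have : ψ (x₀ + c • y) = φ y := by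
          simp [hψ, smul_smul, inv_mul_cancel₀ hc.ne']
        simp only [smul_stPull_kernel_apply, this]
        ring
      rw [h1, integral_const_mul, integral_comp_space_affine hc x₀ (fun x => ψ x * G (T + c ^ 2 * s) x),
        smul_eq_mul, ← mul_assoc, ← hn, mul_inv_cancel₀ (by positivity), one_mul]
    simp_rw [hint]
    exact hlim.comp (tendsto_zoomTime_nhdsLT hc.ne' T)

/-- The zoom of an adapted kernel on `[t₀, T)` with pole `(T, x₀)` is an adapted kernel on
`[(t₀ − T)/c², 0)` with pole `(0, 0)`. [folklore] -/
theorem isAdaptedBackwardKernel_zoom_Ico {ν : ℝ} {u : ℝ → E → E} {t₀ T : ℝ} {x₀ : E}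
    {G : ℝ → E → ℝ} (hG : IsAdaptedBackwardKernel ν u (Ico t₀ T) T x₀ G) {c : ℝ} (hc : 0 < c) :
    IsAdaptedBackwardKernel ν (c • stPull (c ^ 2) c T x₀ u) (Ico ((t₀ - T) / c ^ 2) 0) 0 0
      ((c ^ Module.finrank ℝ E) • stPull (c ^ 2) c T x₀ G) := by
  have h := isAdaptedBackwardKernel_zoom hG hc
  rwa [preimage_zoomTime_Ico hc.ne'] at h

/-! ### Gaussian comparability under the zoom -/

omit [FiniteDimensional ℝ E] [MeasurableSpace E] [BorelSpace E] in
/-- Scaling of the Gaussian profile: for `c > 0`, `a ∈ ℝ` and `y ∈ E`,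
`cⁿ · (c² a)^{-n/2} · exp(−‖c y‖²/(k c² a)) = a^{-n/2} exp(−‖y‖²/(k a))` whenever `0 ≤ a`.
[folklore] -/
theorem gaussianProfile_zoom {c : ℝ} (hc : 0 < c) (K k : ℝ) {a : ℝ} (ha : 0 ≤ a) (y : E) :
    c ^ Module.finrank ℝ E *
        (K * (c ^ 2 * a) ^ (-(Module.finrank ℝ E : ℝ) / 2) *
          Real.exp (-(‖c • y‖ ^ 2) / (k * (c ^ 2 * a)))) =
      K * a ^ (-(Module.finrank ℝ E : ℝ) / 2) * Real.exp (-(‖y‖ ^ 2) / (k * a)) := by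
  set n := Module.finrank ℝ E with hn
  have hc2 : 0 < c ^ 2 := by positivity
  -- the power
  have hpow : (c ^ 2 * a) ^ (-(n : ℝ) / 2) = (c ^ n)⁻¹ * a ^ (-(n : ℝ) / 2) := by
    rw [Real.mul_rpow hc2.le ha]
    congr 1
    rw [show (c ^ 2 : ℝ) = c ^ (2 : ℝ) by norm_cast, ← Real.rpow_mul hc.le,
      show (2 : ℝ) * (-(n : ℝ) / 2) = -(n : ℝ) by ring, Real.rpow_neg hc.le, Real.rpow_natCast]
  -- the exponent
  have hexp : -(‖c • y‖ ^ 2) / (k * (c ^ 2 * a)) = -(‖y‖ ^ 2) / (k * a) := by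
    rw [norm_smul, Real.norm_eq_abs, abs_of_pos hc, mul_pow]
    rw [show k * (c ^ 2 * a) = c ^ 2 * (k * a) by ring, ← mul_neg, mul_div_mul_left _ _ hc2.ne']
  rw [hpow, hexp]
  have hcn : (c ^ n : ℝ) ≠ 0 := by positivity
  field_simp

omit [FiniteDimensional ℝ E] [MeasurableSpace E] [BorelSpace E] in
/-- **Pointwise Gaussian bounds are covariant under the zoom with the same constants.** If
`c₁ (T−t)^{-n/2} e^{−‖x−x₀‖²/(c₂(T−t))} ≤ G(t, x) ≤ C₁ (T−t)^{-n/2} e^{−‖x−x₀‖²/(C₂(T−t))}` at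
`(t, x) = Φ(s, y)` with `s ≤ 0`, then the same two bounds hold for `G_c = cⁿ G ∘ Φ` at `(s, y)`
with pole `(0, 0)`. [folklore] -/
theorem gaussian_bounds_zoom {G : ℝ → E → ℝ} {T : ℝ} {x₀ : E} {c₁ c₂ C₁ C₂ : ℝ} {c : ℝ}
    (hc : 0 < c) {s : ℝ} (hs : s ≤ 0) (y : E)
    (h : c₁ * (T - (T + c ^ 2 * s)) ^ (-(Module.finrank ℝ E : ℝ) / 2) *
          Real.exp (-(‖(x₀ + c • y) - x₀‖ ^ 2) / (c₂ * (T - (T + c ^ 2 * s)))) ≤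
        G (T + c ^ 2 * s) (x₀ + c • y) ∧
      G (T + c ^ 2 * s) (x₀ + c • y) ≤
        C₁ * (T - (T + c ^ 2 * s)) ^ (-(Module.finrank ℝ E : ℝ) / 2) *
          Real.exp (-(‖(x₀ + c • y) - x₀‖ ^ 2) / (C₂ * (T - (T + c ^ 2 * s))))) :
    c₁ * ((0 : ℝ) - s) ^ (-(Module.finrank ℝ E : ℝ) / 2) *
          Real.exp (-(‖y - (0 : E)‖ ^ 2) / (c₂ * ((0 : ℝ) - s))) ≤
        ((c ^ Module.finrank ℝ E) • stPull (c ^ 2) c T x₀ G) s y ∧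
      ((c ^ Module.finrank ℝ E) • stPull (c ^ 2) c T x₀ G) s y ≤
        C₁ * ((0 : ℝ) - s) ^ (-(Module.finrank ℝ E : ℝ) / 2) *
          Real.exp (-(‖y - (0 : E)‖ ^ 2) / (C₂ * ((0 : ℝ) - s))) := by
  have ha : (0 : ℝ) ≤ 0 - s := by linarith
  rw [sub_zoomTime, add_sub_cancel_left] at h
  rw [smul_stPull_kernel_apply, sub_zero, ← gaussianProfile_zoom hc c₁ c₂ ha y,
    ← gaussianProfile_zoom hc C₁ C₂ ha y]
  have hcn : 0 < (c ^ Module.finrank ℝ E : ℝ) := by positivity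
  exact ⟨mul_le_mul_of_nonneg_left h.1 hcn.le, mul_le_mul_of_nonneg_left h.2 hcn.le⟩

omit [FiniteDimensional ℝ E] [MeasurableSpace E] [BorelSpace E] in
/-- **Two-sided Gaussian comparability is covariant under the zoom**, with the same constants: if
`G` is Gaussian-comparable on `S ⊆ (−∞, T]` about `(T, x₀)` then `cⁿ G ∘ Φ` is Gaussian-comparable
on `Φ⁻¹(S)` about `(0, 0)`. [folklore] -/
theorem isGaussianComparable_zoom {G : ℝ → E → ℝ} {S : Set ℝ} {T : ℝ} {x₀ : E}
    (h : IsGaussianComparable G S T x₀) (hS : S ⊆ Iic T) {c : ℝ} (hc : 0 < c) :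
    IsGaussianComparable ((c ^ Module.finrank ℝ E) • stPull (c ^ 2) c T x₀ G)
      ((fun r => T + c ^ 2 * r) ⁻¹' S) 0 0 := by
  obtain ⟨c₁, c₂, C₁, C₂, h₁, h₂, h₃, h₄, hb⟩ := h
  refine ⟨c₁, c₂, C₁, C₂, h₁, h₂, h₃, h₄, fun s hs y => ?_⟩
  have ht : T + c ^ 2 * s ∈ S := hs
  have hs0 : s ≤ 0 := by
    have h1 : T + c ^ 2 * s ≤ T := hS ht
    have hc2 : 0 < c ^ 2 := by positivity
    nlinarith
  exact gaussian_bounds_zoom hc hs0 y (hb _ ht _)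

end Kernel

end Summit.NavierStokesRegularity.NavierStokesRegularity.Theorems

end
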